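import Summits.ValiantsHypothesis.ValiantsHypothesis.Theorems.LacunarySymmetroidMatrixDescartesPivotRankOneCriticalWindowsFourFoldCubic

/-!
# `MatrixDescartes` census — rank-one `(2,4)₁`: THE FASTEST-LONE-LETTER LAW ON THE LEFT SIDE (`K = 4`), by inversion symmetry

HONEST FRAMING.  Object-search cell `pub-symmetroid`, seat `val-sym-mdr-p1` (generation 23); helper file `--supports` the crux item
stmt-ValiantsHypothesis-18050 (`Theses.LacunarySymmetroid.MatrixDescartes`, OPEN, on HOLD) with NO closure claim.  The mirror of
`…FourFoldCubic.lone_letter_four_right`: ONE letter `i` BELOW the pivot letter (at `tᵢ < t₀`), two letters `k, j` beyond it, the lone letter of the LARGEST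
rate (`bᵢ > bₖ, bⱼ`), pencil-coupled exponents, any positive weights ⇒ no three critical directions `0 < T₁ < T₂ < T₃ < t₀`.  Proof: the inversion
`T ↦ 1/T`, `tₘ ↦ 1/tₘ`, `wₘ ↦ wₘtₘ²` maps the two critical equations to themselves (up to the factors `−T²`, `T²`) and swaps the sides of the pivot, so the
right-side theorem applies.  A count for one more cell of the rank-one `(2,4)₁` row; everything else (`MatrixDescartes`, registers, `VP ≠ VNP`) untouched.
[folklore] No definitions, no named facts.
-/

-- `Summit.ValiantsHypothesis.ValiantsHypothesis.…` repeats a component by the D-0017 layout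
-- (single-conjunct summit), which the `dupNamespace` linter flags; the name is mandated.
set_option linter.dupNamespace false

namespace Summit.ValiantsHypothesis.ValiantsHypothesis.Theorems.LacunarySymmetroidMatrixDescartes.Pivot.CriticalWindows.Four

/-- The two critical expressions under the inversion `T ↦ 1/T`, `t ↦ 1/t`, `w ↦ w·t²`. [folklore] -/
theorem critical_inversion {a bi bk bj t₀ ti tk tj w₀ wi wk wj x T : ℝ} {d₀ di dk dj : ℕ} (hT : T ≠ 0) (ht₀ : t₀ ≠ 0) (hti : ti ≠ 0)
    (htk : tk ≠ 0) (htj : tj ≠ 0)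
    (c : w₀ * x ^ d₀ * (T ^ 2 - t₀ ^ 2) + wi * x ^ di * (T ^ 2 - ti ^ 2) + wk * x ^ dk * (T ^ 2 - tk ^ 2) + wj * x ^ dj * (T ^ 2 - tj ^ 2) = 0)
    (c' : w₀ * x ^ d₀ * (-a * (T - t₀) ^ 2) + wi * x ^ di * (bi * (T - ti) ^ 2) + wk * x ^ dk * (bk * (T - tk) ^ 2) + wj * x ^ dj * (bj * (T - tj) ^ 2) = 0) :
    (w₀ * t₀ ^ 2) * x ^ d₀ * ((1 / T) ^ 2 - (1 / t₀) ^ 2) + (wk * tk ^ 2) * x ^ dk * ((1 / T) ^ 2 - (1 / tk) ^ 2) + (wj * tj ^ 2) * x ^ dj * ((1 / T) ^ 2 - (1 / tj) ^ 2) + (wi * ti ^ 2) * x ^ di * ((1 / T) ^ 2 - (1 / ti) ^ 2) = 0 ∧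
    (w₀ * t₀ ^ 2) * x ^ d₀ * (-a * ((1 / T) - (1 / t₀)) ^ 2) + (wk * tk ^ 2) * x ^ dk * (bk * ((1 / T) - (1 / tk)) ^ 2) + (wj * tj ^ 2) * x ^ dj * (bj * ((1 / T) - (1 / tj)) ^ 2) + (wi * ti ^ 2) * x ^ di * (bi * ((1 / T) - (1 / ti)) ^ 2) = 0 := by
  constructor
  · have e : (w₀ * t₀ ^ 2) * x ^ d₀ * ((1 / T) ^ 2 - (1 / t₀) ^ 2) + (wk * tk ^ 2) * x ^ dk * ((1 / T) ^ 2 - (1 / tk) ^ 2) + (wj * tj ^ 2) * x ^ dj * ((1 / T) ^ 2 - (1 / tj) ^ 2) + (wi * ti ^ 2) * x ^ di * ((1 / T) ^ 2 - (1 / ti) ^ 2)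
        = -(1 / T ^ 2) * (w₀ * x ^ d₀ * (T ^ 2 - t₀ ^ 2) + wi * x ^ di * (T ^ 2 - ti ^ 2) + wk * x ^ dk * (T ^ 2 - tk ^ 2) + wj * x ^ dj * (T ^ 2 - tj ^ 2)) := by
      field_simp
      ring
    rw [e, c, mul_zero]
  · have e : (w₀ * t₀ ^ 2) * x ^ d₀ * (-a * ((1 / T) - (1 / t₀)) ^ 2) + (wk * tk ^ 2) * x ^ dk * (bk * ((1 / T) - (1 / tk)) ^ 2) + (wj * tj ^ 2) * x ^ dj * (bj * ((1 / T) - (1 / tj)) ^ 2) + (wi * ti ^ 2) * x ^ di * (bi * ((1 / T) - (1 / ti)) ^ 2)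
        = (1 / T ^ 2) * (w₀ * x ^ d₀ * (-a * (T - t₀) ^ 2) + wi * x ^ di * (bi * (T - ti) ^ 2) + wk * x ^ dk * (bk * (T - tk) ^ 2) + wj * x ^ dj * (bj * (T - tj) ^ 2)) := by
      field_simp
      ring
    rw [e, c', mul_zero]

/-- **THE FASTEST-LONE-LETTER LAW (`K = 4`, LEFT side): AT MOST TWO CRITICAL DIRECTIONS BELOW THE PIVOT LETTER.**  Letters: pivot at `t₀` (rate `−a`),
`i` ALONE at `tᵢ < t₀` with the largest rate `bᵢ > bₖ, bⱼ`, letters `k, j` at `tₖ, tⱼ > t₀`; exponents `d₀ < dₖ, dⱼ` coupled as in the pencil; any positive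
weights: there are no three critical points `(x₁,T₁), (x₂,T₂), (x₃,T₃)` with `0 < T₁ < T₂ < T₃ < t₀`. [folklore] -/
theorem lone_letter_four_left {a bi bk bj t₀ ti tk tj w₀ wi wk wj : ℝ} {d₀ di dk dj : ℕ}
    (ha : 0 < a) (hbi : 0 < bi) (hbk : 0 < bk) (hbj : 0 < bj) (hki : bk < bi) (hji : bj < bi)
    (hti : 0 < ti) (hi0 : ti < t₀) (h0k : t₀ < tk) (h0j : t₀ < tj)
    (hw₀ : 0 < w₀) (hwi : 0 < wi) (hwk : 0 < wk) (hwj : 0 < wj) (h0k' : d₀ < dk) (h0j' : d₀ < dj)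
    (hckj : (a + bk) * ((dj : ℝ) - d₀) = (a + bj) * ((dk : ℝ) - d₀)) (hcki : (a + bk) * ((di : ℝ) - d₀) = (a + bi) * ((dk : ℝ) - d₀))
    {x₁ x₂ x₃ T₁ T₂ T₃ : ℝ} (hx₁ : 0 < x₁) (hx₂ : 0 < x₂) (hx₃ : 0 < x₃)
    (hT₁ : 0 < T₁) (h12 : T₁ < T₂) (h23 : T₂ < T₃) (h30 : T₃ < t₀)
    (c₁ : w₀ * x₁ ^ d₀ * (T₁ ^ 2 - t₀ ^ 2) + wi * x₁ ^ di * (T₁ ^ 2 - ti ^ 2) + wk * x₁ ^ dk * (T₁ ^ 2 - tk ^ 2) + wj * x₁ ^ dj * (T₁ ^ 2 - tj ^ 2) = 0)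
    (c₁' : w₀ * x₁ ^ d₀ * (-a * (T₁ - t₀) ^ 2) + wi * x₁ ^ di * (bi * (T₁ - ti) ^ 2) + wk * x₁ ^ dk * (bk * (T₁ - tk) ^ 2) + wj * x₁ ^ dj * (bj * (T₁ - tj) ^ 2) = 0)
    (c₂ : w₀ * x₂ ^ d₀ * (T₂ ^ 2 - t₀ ^ 2) + wi * x₂ ^ di * (T₂ ^ 2 - ti ^ 2) + wk * x₂ ^ dk * (T₂ ^ 2 - tk ^ 2) + wj * x₂ ^ dj * (T₂ ^ 2 - tj ^ 2) = 0)
    (c₂' : w₀ * x₂ ^ d₀ * (-a * (T₂ - t₀) ^ 2) + wi * x₂ ^ di * (bi * (T₂ - ti) ^ 2) + wk * x₂ ^ dk * (bk * (T₂ - tk) ^ 2) + wj * x₂ ^ dj * (bj * (T₂ - tj) ^ 2) = 0)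
    (c₃ : w₀ * x₃ ^ d₀ * (T₃ ^ 2 - t₀ ^ 2) + wi * x₃ ^ di * (T₃ ^ 2 - ti ^ 2) + wk * x₃ ^ dk * (T₃ ^ 2 - tk ^ 2) + wj * x₃ ^ dj * (T₃ ^ 2 - tj ^ 2) = 0)
    (c₃' : w₀ * x₃ ^ d₀ * (-a * (T₃ - t₀) ^ 2) + wi * x₃ ^ di * (bi * (T₃ - ti) ^ 2) + wk * x₃ ^ dk * (bk * (T₃ - tk) ^ 2) + wj * x₃ ^ dj * (bj * (T₃ - tj) ^ 2) = 0) :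
    False := by
  have ht₀ : 0 < t₀ := lt_trans hti hi0
  have hT₂ : 0 < T₂ := lt_trans hT₁ h12
  have hT₃ : 0 < T₃ := lt_trans hT₂ h23
  have htk : 0 < tk := lt_trans ht₀ h0k
  have htj : 0 < tj := lt_trans ht₀ h0j
  obtain ⟨e₃, e₃'⟩ := critical_inversion (ne_of_gt hT₃) (ne_of_gt ht₀) (ne_of_gt hti) (ne_of_gt htk) (ne_of_gt htj) c₃ c₃'
  obtain ⟨e₂, e₂'⟩ := critical_inversion (ne_of_gt hT₂) (ne_of_gt ht₀) (ne_of_gt hti) (ne_of_gt htk) (ne_of_gt htj) c₂ c₂'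
  obtain ⟨e₁, e₁'⟩ := critical_inversion (ne_of_gt hT₁) (ne_of_gt ht₀) (ne_of_gt hti) (ne_of_gt htk) (ne_of_gt htj) c₁ c₁'
  exact lone_letter_four_right (t₀ := 1 / t₀) (ti := 1 / tk) (tk := 1 / tj) (tj := 1 / ti) (w₀ := w₀ * t₀ ^ 2) (wi := wk * tk ^ 2)
    (wk := wj * tj ^ 2) (wj := wi * ti ^ 2) ha hbk hbj hbi hki hji (one_div_pos.mpr htk) (one_div_pos.mpr htj)
    (one_div_lt_one_div_of_lt ht₀ h0k) (one_div_lt_one_div_of_lt ht₀ h0j) (one_div_lt_one_div_of_lt hti hi0)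
    (mul_pos hw₀ (pow_pos ht₀ 2)) (mul_pos hwk (pow_pos htk 2)) (mul_pos hwj (pow_pos htj 2)) (mul_pos hwi (pow_pos hti 2)) h0k' h0j' hckj hcki
    hx₃ hx₂ hx₁ (one_div_lt_one_div_of_lt hT₃ h30) (one_div_lt_one_div_of_lt hT₂ h23) (one_div_lt_one_div_of_lt hT₁ h12)
    e₃ e₃' e₂ e₂' e₁ e₁'

end Summit.ValiantsHypothesis.ValiantsHypothesis.Theorems.LacunarySymmetroidMatrixDescartes.Pivot.CriticalWindows.Four
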